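import Mathlib
import HarnessLib
import Literature.Analysis.FluidPDE.VectorCalculus
import Literature.Analysis.FluidPDE.VectorCalculusProofs
import Literature.Analysis.FluidPDE.VorticityCalculus
import Literature.Analysis.FluidPDE.LocalBiotSavartCalculus
import Summits.NavierStokesRegularity.NavierStokesRegularity.Theorems.UnthreadedRigidityDoorWindowAnalyticLocal
import Summits.NavierStokesRegularity.NavierStokesRegularity.Theorems.UnthreadedRigidityDoorUnthreadedRigidityVirialHornShellFields
import Summits.NavierStokesRegularity.NavierStokesRegularity.Theorems.UnthreadedRigidityDoorUnthreadedRigidityThreadingJetsWindowGeneric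
import Summits.NavierStokesRegularity.NavierStokesRegularity.Theorems.UnthreadedRigidityDoorUnthreadedRigidityPersistenceWindowVorticity

/-!
# Route `UnthreadedRigidityDoor`, wall item W2 `UnthreadedRigidity` (stmt-NavierStokesRegularity-27585) — LINE g12-2 «PERSISTENCE FILTER»
# (ns-idea-6 g12, `Persistence_sketch.lean` 09bc8f71301208c4; DIRECTOR-NS #294): bridge M «WINDOW VORTICITY BALANCE», REPAIRED FORM
# (part M2: `∂ₜ` and `Δ` preserve the `Y`-toroidal class; profile analyticity under `Y ≢ 0`)

Seat ns-es-p1 g8 (W2 second queue).  The sketch's `WindowVorticityBalance` is false in the degenerate case `Y ≡ 0` (its analyticity conjunct;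
`…PersistenceWindowBalanceCounterexample.not_windowVorticityBalance`); this file proves the one-hypothesis repair `C′` (insert `(∃ y, Y y ≠ 0)`)
and the unconditional toroidal-balance conjunct.

* `window_toroidal_balance` — in a bounded mild window whose slices are single shells `sepShellL (H t) Y x₀` over a fixed solid harmonic `Y`
  (admissible profiles), every slice is TOROIDALLY BALANCED: `curl(ω × u)(x₀ + y) = e(|y|) ∇Y(y) × y` off the axis-free origin.  PROOF: the
  classical vorticity equation of the window (`window_lambCurl_eq`, M1) gives `curl(ω × u) = Δω − ∂ₜω`.  The vorticity of a shell is toroidal,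
  `ω_s(x₀ + y) = −c_s(|y|²) ∇Y × y` (`exists_curl_curl_curl_shell`), i.e. `ω_s = curl` of the shell with profile `−c_s`; hence (`div ω = 0`,
  `curl curl = −Δ`) `Δω = −curl curl curl(shell_{−c}) = c₂(|y|²) ∇Y × y` is toroidal; and `∂ₜω(x₀ + y) = (d/ds)(−c_s(|y|²))·∇Y × y` is toroidal
  because the scalar coefficient depends on `y` only through `|y|` (its differentiability in `s` is read off `ω` where `∇Y × y ≠ 0`).
* `window_analyticOnNhd_profile` — for `Y ≢ 0` the profiles are real-analytic on `(0,∞)` (interior analyticity of the window,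
  `analyticOnNhd_uncurry_of_oseenMild_of_isOpen`, and `…ThreadingJets.analyticOnNhd_profile`).
* `windowVorticityBalance_of_ne` — **bridge M, repaired (`C′`)**: the sketch's `WindowVorticityBalance` with `(∃ y, Y y ≠ 0)` inserted after
  `IsSolidHarmonic l Y` (the sketch-local `IsToroidallyBalanced`/`lambCurl`/`torShell` unfolded).

HONEST LABEL: bookkeeping about special separable data inside a bounded mild window (support of a files-only rung line); nothing here bears on
`UnthreadedRigidity` (27585), the door Target, W2 or Navier–Stokes regularity; no summit statement is proved.  MODEL/rung work; 0 kit.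
-/

noncomputable section

-- the summit and its single sub-problem share the name (CONVENTIONS §1), as in every Theorems file
set_option linter.dupNamespace false

namespace Summit.NavierStokesRegularity.NavierStokesRegularity.Theorems.UnthreadedRigidity.Persistence

open Set Function Filter Topology
open scoped RealInnerProductSpace Laplacian ContDiff
open Literature.Analysis Literature.Analysis.FluidPDE
open Literature.Analysis.UnboundedOperators (heatExtension)
open Summit.NavierStokesRegularity.NavierStokesRegularity.Theorems.UnthreadedRigidity
open Summit.NavierStokesRegularity.NavierStokesRegularity.Theorems.UnthreadedRigidity.ProfileHorn (E3)
open Summit.NavierStokesRegularity.NavierStokesRegularity.Theorems.UnthreadedRigidity.VirialHorn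
  (IsSolidHarmonic VirialAdmissible sepShellL exists_curl_curl_curl_shell sepShellL_eq_comp_sub laplacian_comp_sub_const curl_shell_eq
    curl_comp_sub_const_fun contDiff_shell)
open Summit.NavierStokesRegularity.NavierStokesRegularity.Theorems.UnthreadedRigidity.ThreadingJets (analyticOnNhd_profile)

variable {S : Set ℝ} {u : ℝ → E3 → E3} {x₀ : E3}

/-! ## Toroidal balance of single-shell slices -/

/-- **Single-shell slices of a bounded mild window are toroidally balanced**: `curl(ω × u)(x₀ + y) = e(|y|) ∇Y(y) × y` for `y ≠ 0`
(module docstring). -/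
theorem window_toroidal_balance (hS : IsOpen S) (hcont : ContinuousOn (uncurry u) (S ×ˢ univ))
    (hdiv : ∀ t ∈ S, VectorCalculus.IsDivFree (u t))
    (hmild : ∀ s ∈ S, ∀ t ∈ S, s < t → ∀ x, u t x = heatExtension (u s) (t - s) x - oseenDuhamel 1 s u u t x)
    (hbdd : ∀ τ ∈ S, ∃ B : ℝ, ∀ t ∈ S, t ≤ τ → ∀ x, ‖u t x‖ ≤ B)
    {l : ℕ} {Y : E3 → ℝ} {Hf : ℝ → ℝ → ℝ} (hY : IsSolidHarmonic l Y)
    (hadm : ∀ t ∈ S, VirialAdmissible l (Hf t)) (hshell : ∀ t ∈ S, u t = sepShellL (Hf t) Y x₀) {t : ℝ} (ht : t ∈ S) :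
    ∃ e : ℝ → ℝ, ∀ y : E3, y ≠ 0 →
      curl (fun x => cross (curl (u t) x) (u t x)) (x₀ + y) = e ‖y‖ • cross (gradient Y y) y := by
  -- smooth even representatives of the profiles and the toroidal vorticity coefficients
  have hadm1 : ∀ s ∈ S, ∃ h : ℝ → ℝ, ContDiff ℝ (⊤ : ℕ∞) h ∧ ∀ r : ℝ, 0 ≤ r → Hf s r = h (r ^ 2) :=
    fun s hs => (hadm s hs).1
  choose! hrep hhc hHh using hadm1
  have hc : ∀ s ∈ S, ∃ c : ℝ → ℝ, ContDiff ℝ (⊤ : ℕ∞) c ∧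
      curl (curl (curl (fun z : E3 => (hrep s (‖z‖ ^ 2) * Y z) • z))) =
        fun y : E3 => -(c (‖y‖ ^ 2) • cross (gradient Y y) y) :=
    fun s hs => exists_curl_curl_curl_shell (hhc s hs) hY
  choose! c hcc hcurl using hc
  -- the vorticity of the slices
  have hωfun : ∀ s ∈ S, curl (u s) = fun x : E3 => -(c s (‖x - x₀‖ ^ 2) • cross (gradient Y (x - x₀)) (x - x₀)) := by
    intro s hs
    rw [hshell s hs, sepShellL_eq_comp_sub (hHh s hs) Y x₀, curl_comp_sub_const_fun, hcurl s hs]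
  have hω : ∀ s ∈ S, ∀ y : E3, curl (u s) (x₀ + y) = -(c s (‖y‖ ^ 2) • cross (gradient Y y) y) := by
    intro s hs y
    rw [hωfun s hs]
    simp only [add_sub_cancel_left]
  -- `Δω` at time `t` is toroidal: `ω_t = curl (shell with profile −c_t)`, `curl curl ω = −Δω`
  have hYd : Differentiable ℝ Y := hY.contDiff.differentiable (by simp)
  have hct : ContDiff ℝ (⊤ : ℕ∞) (fun σ => -c t σ) := (hcc t ht).neg
  have hV : ContDiff ℝ (⊤ : ℕ∞) (fun z : E3 => ((fun σ => -c t σ) (‖z‖ ^ 2) * Y z) • z) := contDiff_shell hct hY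
  have hTshell : (fun z : E3 => -(c t (‖z‖ ^ 2) • cross (gradient Y z) z)) =
      curl (fun z : E3 => ((fun σ => -c t σ) (‖z‖ ^ 2) * Y z) • z) := by
    rw [curl_shell_eq (h := fun σ => -c t σ) (hct.differentiable (by simp)) hYd]
    funext z
    rw [neg_smul]
  obtain ⟨c₂, -, hcurl₂⟩ := exists_curl_curl_curl_shell (h := fun σ => -c t σ) hct hY
  have hΔ : ∀ y : E3, (Δ (curl (u t))) (x₀ + y) = c₂ (‖y‖ ^ 2) • cross (gradient Y y) y := by
    intro y
    have hV2 : ContDiff ℝ 2 (curl (fun z : E3 => ((fun σ => -c t σ) (‖z‖ ^ 2) * Y z) • z)) :=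
      contDiff_curl (n := 2) (hV.of_le (by norm_cast))
    have hdivV : VectorCalculus.IsDivFree (curl (fun z : E3 => ((fun σ => -c t σ) (‖z‖ ^ 2) * Y z) • z)) :=
      fun z => divergence_curl_eq_zero_holds _ (hV.of_le (by norm_cast)) z
    have hωt : curl (u t) = fun x : E3 => curl (fun z : E3 => ((fun σ => -c t σ) (‖z‖ ^ 2) * Y z) • z) (x - x₀) := by
      rw [hωfun t ht, ← hTshell]
    rw [hωt, laplacian_comp_sub_const]
    have h1 := curl_curl_eq_neg_laplacian hV2 hdivV (x₀ + y - x₀)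
    rw [hcurl₂] at h1
    simp only [add_sub_cancel_left] at h1 ⊢
    exact (neg_inj.1 h1).symm
  -- `∂ₜω` at time `t` is toroidal
  have hDt : ∀ y : E3, deriv (fun s => curl (u s) (x₀ + y)) t =
      deriv (fun s => -c s (‖y‖ ^ 2)) t • cross (gradient Y y) y := by
    intro y
    set W : E3 := cross (gradient Y y) y with hW
    have hev : (fun s => curl (u s) (x₀ + y)) =ᶠ[𝓝 t] fun s => (-c s (‖y‖ ^ 2)) • W := by
      filter_upwards [hS.mem_nhds ht] with s hs
      rw [hω s hs y, neg_smul]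
    rw [hev.deriv_eq]
    by_cases hW0 : W = 0
    · simp [hW0]
    · have hdiff : DifferentiableAt ℝ (fun s => (-c s (‖y‖ ^ 2)) • W) t :=
        (window_differentiable_time_curl hS hcont hdiv hmild hbdd ht (x₀ + y)).congr_of_eventuallyEq hev.symm
      have hWn : ‖W‖ ≠ 0 := norm_ne_zero_iff.2 hW0
      have hg : DifferentiableAt ℝ (fun s => -c s (‖y‖ ^ 2)) t := by
        have h1 : DifferentiableAt ℝ (fun s => (‖W‖ ^ 2)⁻¹ * ⟪(-c s (‖y‖ ^ 2)) • W, W⟫) t :=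
          (hdiff.inner ℝ (differentiableAt_const W)).const_mul _
        have h2 : (fun s => (‖W‖ ^ 2)⁻¹ * ⟪(-c s (‖y‖ ^ 2)) • W, W⟫) = fun s => -c s (‖y‖ ^ 2) := by
          funext s
          rw [real_inner_smul_left, real_inner_self_eq_norm_sq]
          field_simp
        rw [h2] at h1
        exact h1
      rw [deriv_smul_const hg]
  -- assemble through the vorticity equation of the window
  refine ⟨fun r => c₂ (r ^ 2) - deriv (fun s => -c s (r ^ 2)) t, fun y _ => ?_⟩
  have hvort := window_lambCurl_eq hS hcont hdiv hmild hbdd ht (x₀ + y)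
  rw [hΔ y, hDt y] at hvort
  rw [sub_smul]
  exact eq_sub_of_add_eq' hvort

/-! ## Analyticity of the profiles -/

/-- **In a bounded mild window whose slices are single shells over a NONZERO harmonic, the profiles are real-analytic on `(0,∞)`.** -/
theorem window_analyticOnNhd_profile (hS : IsOpen S) (hcont : ContinuousOn (uncurry u) (S ×ˢ univ))
    (hmild : ∀ s ∈ S, ∀ t ∈ S, s < t → ∀ x, u t x = heatExtension (u s) (t - s) x - oseenDuhamel 1 s u u t x)
    (hbdd : ∀ τ ∈ S, ∃ B : ℝ, ∀ t ∈ S, t ≤ τ → ∀ x, ‖u t x‖ ≤ B)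
    {l : ℕ} {Y : E3 → ℝ} {Hf : ℝ → ℝ → ℝ} (hl : 1 ≤ l) (hY : IsSolidHarmonic l Y) (hYne : ∃ y, Y y ≠ 0)
    (hadm : ∀ t ∈ S, VirialAdmissible l (Hf t)) (hshell : ∀ t ∈ S, u t = sepShellL (Hf t) Y x₀) {t : ℝ} (ht : t ∈ S) :
    AnalyticOnNhd ℝ (Hf t) (Ioi 0) := by
  have han := analyticOnNhd_uncurry_of_oseenMild_of_isOpen hS hcont hmild hbdd
  have hslice : AnalyticOnNhd ℝ (u t) univ := by
    intro x _
    have h1 : AnalyticAt ℝ (uncurry u) (t, x) := han (t, x) ⟨ht, mem_univ _⟩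
    have h2 : AnalyticAt ℝ (fun z : E3 => (t, z)) x := analyticAt_const.prod analyticAt_id
    exact h1.comp h2
  rw [hshell t ht] at hslice
  exact analyticOnNhd_profile hl hY (hadm t ht) x₀ hslice hYne

/-! ## Bridge M, repaired -/

/-- **Bridge M «WINDOW VORTICITY BALANCE», repaired form `C′`** — the sketch's `WindowVorticityBalance` VERBATIM with the hypothesis
`(∃ y, Y y ≠ 0)` inserted after `IsSolidHarmonic l Y` (sketch-local `IsToroidallyBalanced` / `lambCurl` / `torShell` unfolded); the sketch's
form without it is refuted by `not_windowVorticityBalance`. -/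
theorem windowVorticityBalance_of_ne :
    ∀ (S : Set ℝ), IsOpen S → ∀ (u : ℝ → E3 → E3) (x₀ : E3),
      ContinuousOn (Function.uncurry u) (S ×ˢ Set.univ) →
      (∀ t ∈ S, Literature.Analysis.FluidPDE.VectorCalculus.IsDivFree (u t)) →
      (∀ s ∈ S, ∀ t ∈ S, s < t → ∀ x, u t x =
          Literature.Analysis.UnboundedOperators.heatExtension (u s) (t - s) x
            - Literature.Analysis.FluidPDE.oseenDuhamel 1 s u u t x) →
      (∀ τ ∈ S, ∃ B : ℝ, ∀ t ∈ S, t ≤ τ → ∀ x, ‖u t x‖ ≤ B) →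
      ∀ (l : ℕ) (Y : E3 → ℝ) (Hf : ℝ → ℝ → ℝ), 1 ≤ l → IsSolidHarmonic l Y → (∃ y, Y y ≠ 0) →
        (∀ t ∈ S, VirialAdmissible l (Hf t)) → (∀ t ∈ S, u t = sepShellL (Hf t) Y x₀) →
        ∀ t ∈ S, (∃ e : ℝ → ℝ, ∀ y : E3, y ≠ 0 →
            curl (fun x => cross (curl (u t) x) (u t x)) (x₀ + y)
              = e ‖x₀ + y - x₀‖ • cross (gradient Y (x₀ + y - x₀)) (x₀ + y - x₀)) ∧
          AnalyticOnNhd ℝ (Hf t) (Set.Ioi 0) := by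
  intro S hS u x₀ hcont hdiv hmild hbdd l Y Hf hl hY hYne hadm hshell t ht
  refine ⟨?_, window_analyticOnNhd_profile hS hcont hmild hbdd hl hY hYne hadm hshell ht⟩
  obtain ⟨e, he⟩ := window_toroidal_balance hS hcont hdiv hmild hbdd hY hadm hshell ht
  refine ⟨e, fun y hy => ?_⟩
  rw [he y hy]
  simp only [add_sub_cancel_left]

end Summit.NavierStokesRegularity.NavierStokesRegularity.Theorems.UnthreadedRigidity.Persistence

end
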